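import Mathlib
import HarnessLib
import Literature.NumberTheory.Automorphic.IsobaricRigidityRepData
import Literature.NumberTheory.Automorphic.GaloisActionPlaces
import Literature.NumberTheory.Automorphic.KimExteriorSquareGL4Lemmas
import Literature.NumberTheory.Automorphic.KimExteriorSquareGL4Proofs
import Literature.NumberTheory.Automorphic.TunnellOctahedralGlobalProofs
import Literature.NumberTheory.Automorphic.ArthurClozelCuspidalDescentGLOneHolds
import Literature.NumberTheory.Automorphic.AutomorphicTwistHecke
import Literature.NumberTheory.Automorphic.HeckeCharacterPairRigidity
import Literature.NumberTheory.Automorphic.RamakrishnanMultiplicityOneDihedral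
import Literature.NumberTheory.Automorphic.CuspidalDescentCyclicRepData
import Literature.NumberTheory.Automorphic.AutomorphicInductionCuspidalProofs
import Literature.NumberTheory.Automorphic.AutomorphicGaloisConjProofs
import Literature.NumberTheory.Automorphic.AutomorphicTwistNorm
import Literature.NumberTheory.Automorphic.AdelicGroupDataUniquenessProofs
import Literature.NumberTheory.Automorphic.AdelicGroupDataAutomorphicMeasureProofs
import Literature.NumberTheory.GaloisRepresentations.HeckeCharacter

/-!
# The Galois-conjugate cuspidal Borel–Jacquet datum `P^σ`

Stub `stub_galConjDatum` of the Klein-cube line for the crux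
`Summit.Langlands.Langlands.Theses.ExteriorSquareAscent.InducedSquareAscent`: for a cuspidal
Borel–Jacquet datum `P` on `GL_n(𝔸_E)` (`n ≥ 1`) and `σ ∈ Aut(E/F)` there is a cuspidal datum `P'`
with `t_{P', w} = t_{P, σ w}` at almost every finite place `w` of `E`.

Proof (pattern of `cuspidal_descent_cyclic_of_normalisation`, with "descend" replaced by
"conjugate"): normalise `P` to a cuspidal `Q ≤ L²_cusp(GL_n(𝔸_E) ⧸ A_G GL_n(E), ν)` with a Satake
family `A` off a finite `S`, `t_{P,w} = q_w^{s} A(w)` exactly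
(`CuspidalAutomorphicRepData.exists_satake_eq_cpow_mul_L2_unconditional`); the automorphic measure `ν`
is `Aut(E/F)`-invariant (`isGalInvariant_of_unique`), so the `L²` Galois conjugate
`U_{σ⁻¹}(Q) = Q.galConj σ⁻¹` is cuspidal with Satake family `w ↦ A(σ w)` off `σ⁻¹ S`
(`IsSatakeFamilyOf.galConj`); realise it by a datum `π'` with `t_{π', w} = A(σ w)` a.e.
(`CuspidalAutomorphicRepGL.exists_cuspidalRepData_eventually_hasSatakeParamAt`), and twist back,
`P' := π' ⊗ |det|^{s}` (`exists_cuspidalAutomorphicRepData_map_mulChar_detTwist`,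
`AutomorphicRepData.HasSatakeParamAt.of_map_mulChar_detTwist_of_cpow`): at almost every `w`,
`t_{P', w} = q_w^{s} A(σ w) = q_{σ w}^{s} A(σ w) = t_{P, σ w}` (`residueCard_smul`), the `↔` by the
uniqueness and almost-everywhere existence of Satake parameters
(`hasSatakeParamAt_unique_holds`, `hasSatakeParamAt_cofinite_holds`).
-/

set_option linter.unusedVariables false
set_option linter.dupNamespace false

noncomputable section

namespace Summit.Langlands.Langlands.Theorems.InducedSquareAscentKleinCube

open scoped Classical NumberField
open Filter IsDedekindDomain NumberField
open Literature.NumberTheory.Automorphic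
open Literature.NumberTheory.GaloisRepresentations (HeckeCharacter)

/-- **The Galois-conjugate cuspidal datum `P^σ` in the Borel–Jacquet model.** For `σ ∈ Aut(E/F)`
and a cuspidal Borel–Jacquet datum `P` on `GL_n(𝔸_E)` (`n ≥ 1`) there is a cuspidal datum `P'` on
`GL_n(𝔸_E)` whose Satake parameters at almost every finite place `w` are exactly those of `P` at
`σ • w` (`t_{P^σ, w} = t_{P, σ w}`, Arthur–Clozel 1989, Ch. 1 §2.1 / Ch. 3 §1 for `Π^σ := Π ∘ σ`).
Obtained through the `L²` model: unitary normalisation (Borel–Jacquet 1979, 5.7), the unitary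
Galois conjugate `U_{σ⁻¹}(Q)` on `L²_cusp` (`CuspidalAutomorphicRepGL.galConj`), realisation by a
Borel–Jacquet datum (Borel–Jacquet 1979, 4.6) and the twist back by `|det|^{s}`. [folklore] -/
theorem stub_galConjDatum :
    ∀ (n : ℕ) [NeZero n] (F E : Type) [Field F] [NumberField F] [Field E] [NumberField E]
      [Algebra F E] (hE : isCompact_glFiniteIntegralLevel n E) (σ : E ≃ₐ[F] E)
      (P : CuspidalAutomorphicRepData n E hE),
      ∃ P' : CuspidalAutomorphicRepData n E hE,
        ∀ᶠ w : HeightOneSpectrum (𝓞 E) in cofinite, ∀ β : Multiset ℂ,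
          P'.1.HasSatakeParamAt w β ↔ P.1.HasSatakeParamAt (σ • w) β := by
  intro n _ F E _ _ _ _ _ hE σ P
  -- the automorphic measure on `GL_n(𝔸_E) ⧸ A_G GL_n(E)`, `Aut(E/F)`-invariant by uniqueness
  obtain ⟨ν, hνA⟩ := AdelicGroupData.exists_isAutomorphicMeasure_gl_holds n E
  haveI := hνA
  have hνG : IsGalInvariant F ν :=
    isGalInvariant_of_unique F (AdelicGroupData.isAutomorphicMeasure_unique_smul_holds n E) ν
  -- unitary normalisation `t_{P,w} = q_w^{s} A(w)` off `S`, `A` a Satake family of `Q ≤ L²_cusp`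
  obtain ⟨s, Q, S, A, hS, hAQ, hiff⟩ :=
    CuspidalAutomorphicRepData.exists_satake_eq_cpow_mul_L2_unconditional hE ν P
  -- the `L²` Galois conjugate `U_{σ⁻¹}(Q)`, with Satake family `w ↦ A (σ w)` off `σ⁻¹ S`
  have hAQ' : IsSatakeFamilyOf (Q.galConj F hνG σ⁻¹)
      ((fun w : HeightOneSpectrum (𝓞 E) => σ • w) ⁻¹' S) (fun w => A (σ • w)) := by
    have h := hAQ.galConj F hνG σ⁻¹
    simp only [inv_inv] at h
    exact h
  have hS' : ((fun w : HeightOneSpectrum (𝓞 E) => σ • w) ⁻¹' S).Finite :=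
    hS.preimage (MulAction.injective σ).injOn
  -- a Borel–Jacquet datum `π'` realising `U_{σ⁻¹}(Q)`: `t_{π', w} = A (σ w)` almost everywhere
  obtain ⟨π', hπ'⟩ :=
    CuspidalAutomorphicRepGL.exists_cuspidalRepData_eventually_hasSatakeParamAt hE _ hAQ' hS'
  -- twist back: `π` with `π' = π ⊗ |det|^{s}`-relation `t_{π', w} = q_w^{-s} t_{π, w}`
  obtain ⟨χ, hχ⟩ := exists_heckeCharacter_ideleNorm_cpow E s
  obtain ⟨π, hπW, hπW'⟩ :=
    exists_cuspidalAutomorphicRepData_map_mulChar_detTwist (inv_apply_of_cpow hχ) π'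
  have hπ'W : π'.1.W = π.1.W.map (mulChar (detTwist n χ)) := by
    rw [hπW, detTwist_inv, map_mulChar_map_mulChar_inv]
  have hπ'W' : π'.1.W' = π.1.W'.map (mulChar (detTwist n χ)) := by
    rw [hπW', detTwist_inv, map_mulChar_map_mulChar_inv]
  refine ⟨π, ?_⟩
  have htend : Tendsto (fun w : HeightOneSpectrum (𝓞 E) => σ • w) cofinite cofinite :=
    (MulAction.injective σ).tendsto_cofinite
  have hS'' : ∀ᶠ w : HeightOneSpectrum (𝓞 E) in cofinite, σ • w ∉ S :=
    htend.eventually hS.eventually_cofinite_notMem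
  filter_upwards [hπ', hS'', AutomorphicRepData.hasSatakeParamAt_cofinite_holds π.1]
    with w hw hwS hunr
  intro β
  obtain ⟨α₀, hα₀⟩ := hunr
  have hα₀' : π'.1.HasSatakeParamAt w (α₀.map ((((w.residueCard : ℂ) ^ (-s)) * ·))) :=
    AutomorphicRepData.HasSatakeParamAt.of_map_mulChar_detTwist_of_cpow hχ hπ'W hπ'W' hα₀
  have heq : A (σ • w) = α₀.map (((w.residueCard : ℂ) ^ (-s)) * ·) :=
    AutomorphicRepData.hasSatakeParamAt_unique_holds π'.1 hw hα₀'
  have hq : (w.residueCard : ℂ) ≠ 0 := by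
    have := w.one_lt_residueCard
    exact_mod_cast (by omega : w.residueCard ≠ 0)
  have hα₀eq : (A (σ • w)).map (((w.residueCard : ℂ) ^ s) * ·) = α₀ := by
    rw [heq, Multiset.map_map]
    conv_rhs => rw [← Multiset.map_id α₀]
    refine Multiset.map_congr rfl fun a _ => ?_
    simp only [Function.comp_apply, id]
    rw [← mul_assoc, ← Complex.cpow_add _ _ hq, add_neg_cancel, Complex.cpow_zero, one_mul]
  rw [hiff (σ • w) hwS β, residueCard_smul F σ w, hα₀eq]
  constructor
  · intro h
    exact AutomorphicRepData.hasSatakeParamAt_unique_holds π.1 h hα₀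
  · rintro rfl
    exact hα₀

end Summit.Langlands.Langlands.Theorems.InducedSquareAscentKleinCube

end
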